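import Literature.NumberTheory.EllipticCurves.Curve49A1Points
import HarnessLib

/-!
# Route `Langlands/SqrtFiveQuarticCovers`, sheet 4.5 (`CertB3E7`, stmt-Langlands-23416), row 8:
# the `2`-isogeny-descent LOCAL CERTIFICATES for the twist `W⁵ : Y² = X³ + 1470X² − 8575X`
# (conductor `1225`) and its `2`-isogenous curve `W⁵′ : Y² = X³ − 2940X² + 2195200X`

Cell lg-quartmod (F-L1), seat eng-7 g5.  This is the first of three sibling modules proving, as a
KERNEL THEOREM with no hypothesis, the `ℚ`-point list

  `hQ5 : ∀ X Y : ℚ, Y² = X³ + 1470X² − 8575X → X = 0`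

of `Theorems/SqrtFiveQuarticCoversCertB3E7MordellWeilQ.lean` (p677449: `hMW ⟺ hQ ∧ hQ5`), i.e.
«the quadratic twist by `5` of Cremona's `49a4`, conductor `1225 = 5²·7²`, has `E(ℚ) = {O, (0,0)}
≅ ℤ/2`», by the method the tree already uses for `49a1`, `X₁(14)`, `X₁(2,10)`
(`Literature/NumberTheory/EllipticCurves/Curve49A1Points.lean`, `X1FourteenMordellWeil.lean`,
`KubertTwoTenProofs.lean`): descent via `2`-isogeny (`TwoIsogenyDescent.lean`,
`exists_eq_two_smul_or` + `finite_point_of_twoIsogenyDescent`, the latter through the tree's PROVED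
Mordell–Weil theorem `addGroup_fg_point_holds`), then torsion.

For `E : y² = x(x² + ax + b)` the descent needs, for each square class `[d]`, `d ∣ b` resp.
`d ∣ b′ = a² − 4b`, other than `[1], [b]` resp. `[1], [b′]`, that the torsor
`N² = d M⁴ + a M²e² + (b/d) e⁴` has no integer point with `(M, e)` "primitive"
(Silverman–Tate III.5–6; *AEC* X.4.9).  Here `a = 1470`, `b = −8575 = −5²·7³` (classes
`±1, ±5, ±7, ±35`; `[b] = [−7]`) and `a′ = −2940`, `b′ = 2195200 = 2⁸·5²·7³` (classes
`±1, ±2, ±5, ±7, ±10, ±14, ±35, ±70`; `[b′] = [7]`).  Up to translation by the `2`-torsion point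
(`x ↦ b/x` multiplies the class by `[b]`) and sign, SIX torsors must die, and they die locally:

* `W⁵`, `d = −1`: `N² = −M⁴ + 1470M²e² + 8575e⁴` — `2`-adically (`≡ 12 (mod 16)` for `M, e` odd,
  `≡ 3 (mod 4)` for mixed parity);
* `W⁵`, `d = 5`: `N² = 5M⁴ + 1470M²e² − 1715e⁴` — `5`-adically (`5 ∣ N`, then
  `M⁴ + 294M²e² − 343e⁴ ≡ 0 (mod 5)` forces `5 ∣ M`, `5 ∣ e`);
* `W⁵`, `d = −5`: `N² = −5M⁴ + 1470M²e² + 1715e⁴` — `5`-adically likewise;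
* `W⁵′`, `d = 2`: `N² = 2M⁴ − 2940M²e² + 1097600e⁴` — `2`-adically by a three-step parity chain
  (`M` odd: `≡ 2 (mod 4)`; `M = 2M₁`, `N = 4N₁`, `M₁` odd: `≡ 3 (mod 8)`; `M₁ = 2M₂`, `N₁ = 2N₂`:
  `≡ 2, 6, 7 (mod 8)`), i.e. "no primitive solution mod `2⁸`";
* `W⁵′`, `d = 5`: `N² = 5M⁴ − 2940M²e² + 439040e⁴` — `5`-adically;
* `W⁵′`, `d = 10`: `N² = 10M⁴ − 2940M²e² + 219520e⁴` — `5`-adically.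

Each is reduced to finitely many statements over `ZMod 4 / 8 / 16 / 5` checked by `decide` (default
heartbeats), then lifted to `ℤ` and to the rational form `z² = d u⁴ + a u² + b/d` used by the class
lemmas of the sibling module `…W5DescentClasses.lean`.  My own residue search
(`compute/descent_{local,2adic,deep}.py`, pure python) agrees with eng-8 g3's kit j320342 and ref-1 g2's
re-derivation (STATUS 23:34:02Z / 23:36:21Z).  HONEST STATUS: elementary congruences about six
explicit quartics; nothing here is a modularity or BSD statement.  References: J. H. Silverman,
*The Arithmetic of Elliptic Curves*, 2nd ed., X.4.9 [SilvermanAEC2009]; J. H. Silverman, J. Tate,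
*Rational Points on Elliptic Curves*, III.5–III.6.
-/

set_option linter.dupNamespace false -- project-wide option; `Summit.Langlands.Langlands` is the mandated namespace

namespace Summit.Langlands.Langlands.Theorems.SqrtFiveQuarticCovers.W5Descent

open Literature.NumberTheory.EllipticCurves

/-! ### Generic lifts: a primitive integer torsor point from a rational one -/

/-- **Clearing denominators.** If `z² = d u⁴ + a u² + c` with `u, z ∈ ℚ`, write `u = M/e` in lowest
terms (`M = u.num`, `e = u.den`); then `N = z e²` is an integer with `N² = d M⁴ + a M²e² + c e⁴`
and `M`, `e` are coprime, in particular not both divisible by any prime `p`. [folklore] -/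
theorem exists_int_torsor {d a c : ℤ} {u z : ℚ} (h : z ^ 2 = d * u ^ 4 + a * u ^ 2 + c) :
    ∃ M e N : ℤ, Int.gcd M e = 1 ∧ e ≠ 0 ∧ N ^ 2 = d * M ^ 4 + a * M ^ 2 * e ^ 2 + c * e ^ 4 := by
  set M : ℤ := u.num with hM
  set e : ℕ := u.den with he
  have hu : u * e = M := Rat.mul_den_eq_num u
  have hK : (z * (e : ℚ) ^ 2) ^ 2 =
      ((d * M ^ 4 + a * M ^ 2 * (e : ℤ) ^ 2 + c * (e : ℤ) ^ 4 : ℤ) : ℚ) := by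
    push_cast
    calc (z * (e : ℚ) ^ 2) ^ 2 = z ^ 2 * (e : ℚ) ^ 4 := by ring
      _ = (d * u ^ 4 + a * u ^ 2 + c) * (e : ℚ) ^ 4 := by rw [h]
      _ = d * (u * e) ^ 4 + a * (u * e) ^ 2 * (e : ℚ) ^ 2 + c * (e : ℚ) ^ 4 := by ring
      _ = _ := by rw [hu]
  have hden : (z * (e : ℚ) ^ 2).den = 1 := Rat.den_eq_one_of_sq_eq_intCast hK
  have hNQ : (((z * (e : ℚ) ^ 2).num : ℤ) : ℚ) = z * (e : ℚ) ^ 2 :=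
    Rat.coe_int_num_of_den_eq_one hden
  set N : ℤ := (z * (e : ℚ) ^ 2).num with hN
  refine ⟨M, (e : ℤ), N, ?_, by exact_mod_cast u.den_nz, ?_⟩
  · have hcop : M.natAbs.Coprime e := u.reduced
    rw [Int.gcd, Int.natAbs_natCast]
    exact hcop
  · have : ((N : ℤ) : ℚ) ^ 2 =
        ((d * M ^ 4 + a * M ^ 2 * (e : ℤ) ^ 2 + c * (e : ℤ) ^ 4 : ℤ) : ℚ) := by
      rw [hNQ, hK]
    exact_mod_cast this

/-- From `gcd(M, e) = 1`: a prime (indeed any `p > 1`) does not divide both. [folklore] -/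
theorem not_dvd_and_dvd_of_gcd_eq_one {M e : ℤ} (h : Int.gcd M e = 1) {p : ℕ} (hp : 1 < p) :
    ¬ ((p : ℤ) ∣ M ∧ (p : ℤ) ∣ e) := by
  rintro ⟨hM, he⟩
  have h1 : (p : ℤ) ∣ (Int.gcd M e : ℤ) := Int.dvd_coe_gcd hM he
  rw [h] at h1
  have : p ∣ 1 := by exact_mod_cast h1
  exact absurd (Nat.le_of_dvd one_pos this) (by omega)

/-! ### `W⁵`, class `[-1]`: the torsor `N² = −M⁴ + 1470M²e² + 8575e⁴` dies `2`-adically -/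

/-- For odd `m = 2k+1`, `e = 2l+1`: `−m⁴ + 1470m²e² + 8575e⁴ ≡ 12 (mod 16)`. [folklore] -/
theorem negOne_odd_odd_sixteen :
    ∀ k l : ZMod 16, -(2 * k + 1) ^ 4 + 1470 * (2 * k + 1) ^ 2 * (2 * l + 1) ^ 2
      + 8575 * (2 * l + 1) ^ 4 = 12 := by
  decide

/-- For `m = k + k` even, `e = 2l + 1` odd: `−m⁴ + 1470m²e² + 8575e⁴ ≡ 3 (mod 4)` is not a
square. [folklore] -/
theorem negOne_even_odd_four :
    ∀ k l n : ZMod 4, n ^ 2 ≠ -(k + k) ^ 4 + 1470 * (k + k) ^ 2 * (2 * l + 1) ^ 2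
      + 8575 * (2 * l + 1) ^ 4 := by
  decide

/-- For `m = 2k + 1` odd, `e = l + l` even: `−m⁴ + 1470m²e² + 8575e⁴ ≡ 3 (mod 4)` is not a
square. [folklore] -/
theorem negOne_odd_even_four :
    ∀ k l n : ZMod 4, n ^ 2 ≠ -(2 * k + 1) ^ 4 + 1470 * (2 * k + 1) ^ 2 * (l + l) ^ 2
      + 8575 * (l + l) ^ 4 := by
  decide

/-- **The torsor `N² = −M⁴ + 1470M²e² + 8575e⁴` has no integer point with `M`, `e` not both
even.** [folklore] -/
theorem negOne_int_false {M e N : ℤ} (hcop : ¬ (2 ∣ M ∧ 2 ∣ e))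
    (h : N ^ 2 = -M ^ 4 + 1470 * M ^ 2 * e ^ 2 + 8575 * e ^ 4) : False := by
  rcases Int.even_or_odd M with ⟨k, hk⟩ | ⟨k, hk⟩ <;>
    rcases Int.even_or_odd e with ⟨l, hl⟩ | ⟨l, hl⟩
  · exact hcop ⟨⟨k, by rw [hk]; ring⟩, ⟨l, by rw [hl]; ring⟩⟩
  · subst hk hl
    have h4 := congrArg (Int.cast : ℤ → ZMod 4) h
    push_cast at h4
    exact negOne_even_odd_four _ _ _ h4
  · subst hk hl
    have h4 := congrArg (Int.cast : ℤ → ZMod 4) h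
    push_cast at h4
    exact negOne_odd_even_four _ _ _ h4
  · subst hk hl
    have h16 := congrArg (Int.cast : ℤ → ZMod 16) h
    push_cast at h16
    rw [negOne_odd_odd_sixteen] at h16
    exact ZMod.sq_ne_twelve_sixteen _ h16

/-- **`z² = −u⁴ + 1470u² + 8575` has no rational solution.** [folklore] -/
theorem negOne_rat_false (u z : ℚ) (h : z ^ 2 = -u ^ 4 + 1470 * u ^ 2 + 8575) : False := by
  obtain ⟨M, e, N, hg, -, hN⟩ := exists_int_torsor (d := -1) (a := 1470) (c := 8575) (u := u)
    (z := z) (by push_cast; linear_combination h)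
  refine negOne_int_false (M := M) (e := e) (N := N) ?_ (by linear_combination hN)
  exact_mod_cast not_dvd_and_dvd_of_gcd_eq_one hg (p := 2) one_lt_two

/-! ### The four `5`-adic torsors: `5 ∣ N`, then a residue computation mod `5` -/

/-- `W⁵`, `d = 5`: `M⁴ + 294M²e² − 343e⁴ ≡ 0 (mod 5)` forces `M ≡ e ≡ 0`. [folklore] -/
theorem five_residue :
    ∀ M e : ZMod 5, M ^ 4 + 294 * M ^ 2 * e ^ 2 - 343 * e ^ 4 = 0 → M = 0 ∧ e = 0 := by
  decide

/-- `W⁵`, `d = −5`: `−M⁴ + 294M²e² + 343e⁴ ≡ 0 (mod 5)` forces `M ≡ e ≡ 0`. [folklore] -/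
theorem negFive_residue :
    ∀ M e : ZMod 5, -M ^ 4 + 294 * M ^ 2 * e ^ 2 + 343 * e ^ 4 = 0 → M = 0 ∧ e = 0 := by
  decide

/-- `W⁵′`, `d = 5`: `M⁴ − 588M²e² + 87808e⁴ ≡ 0 (mod 5)` forces `M ≡ e ≡ 0`. [folklore] -/
theorem coFive_residue :
    ∀ M e : ZMod 5, M ^ 4 - 588 * M ^ 2 * e ^ 2 + 87808 * e ^ 4 = 0 → M = 0 ∧ e = 0 := by
  decide

/-- `W⁵′`, `d = 10`: `2M⁴ − 588M²e² + 43904e⁴ ≡ 0 (mod 5)` forces `M ≡ e ≡ 0`. [folklore] -/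
theorem coTen_residue :
    ∀ M e : ZMod 5, 2 * M ^ 4 - 588 * M ^ 2 * e ^ 2 + 43904 * e ^ 4 = 0 → M = 0 ∧ e = 0 := by
  decide

/-- **The `5`-adic step.** If `N² = 5·A` with `A ∈ ℤ`, then `5 ∣ N` and `A = 5·N₁²` for
`N = 5N₁`; in particular `A ≡ 0 (mod 5)`. [folklore] -/
theorem five_dvd_step {N A : ℤ} (h : N ^ 2 = 5 * A) : (A : ZMod 5) = 0 := by
  have h5N : (5 : ℤ) ∣ N := by
    have : (5 : ℤ) ∣ N ^ 2 := ⟨A, h⟩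
    exact Int.Prime.dvd_pow' Nat.prime_five this
  obtain ⟨N₁, rfl⟩ := h5N
  have hA : A = 5 * N₁ ^ 2 := by linarith
  rw [hA]
  push_cast
  have : (5 : ZMod 5) = 0 := by decide
  rw [this, zero_mul]

/-- From `(M : ZMod 5) = 0 ∧ (e : ZMod 5) = 0` to `5 ∣ M ∧ 5 ∣ e`. [folklore] -/
theorem dvd_and_dvd_of_zmod_five {M e : ℤ} (h : (M : ZMod 5) = 0 ∧ (e : ZMod 5) = 0) :
    (((5 : ℕ) : ℤ) ∣ M ∧ ((5 : ℕ) : ℤ) ∣ e) :=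
  ⟨(ZMod.intCast_zmod_eq_zero_iff_dvd M 5).mp h.1, (ZMod.intCast_zmod_eq_zero_iff_dvd e 5).mp h.2⟩

/-- **`W⁵`, `d = 5`: `N² = 5M⁴ + 1470M²e² − 1715e⁴` has no integer point with `M`, `e` not both
divisible by `5`.** [folklore] -/
theorem five_int_false {M e N : ℤ} (hcop : ¬ (((5 : ℕ) : ℤ) ∣ M ∧ ((5 : ℕ) : ℤ) ∣ e))
    (h : N ^ 2 = 5 * M ^ 4 + 1470 * M ^ 2 * e ^ 2 - 1715 * e ^ 4) : False := by
  have hA := five_dvd_step (N := N) (A := M ^ 4 + 294 * M ^ 2 * e ^ 2 - 343 * e ^ 4) (by linear_combination h)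
  push_cast at hA
  exact hcop (dvd_and_dvd_of_zmod_five (five_residue _ _ hA))

/-- **`W⁵`, `d = −5`: `N² = −5M⁴ + 1470M²e² + 1715e⁴` has no integer point with `M`, `e` not both
divisible by `5`.** [folklore] -/
theorem negFive_int_false {M e N : ℤ} (hcop : ¬ (((5 : ℕ) : ℤ) ∣ M ∧ ((5 : ℕ) : ℤ) ∣ e))
    (h : N ^ 2 = -5 * M ^ 4 + 1470 * M ^ 2 * e ^ 2 + 1715 * e ^ 4) : False := by
  have hA := five_dvd_step (N := N) (A := -M ^ 4 + 294 * M ^ 2 * e ^ 2 + 343 * e ^ 4) (by linear_combination h)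
  push_cast at hA
  exact hcop (dvd_and_dvd_of_zmod_five (negFive_residue _ _ hA))

/-- **`W⁵′`, `d = 5`: `N² = 5M⁴ − 2940M²e² + 439040e⁴` has no integer point with `M`, `e` not both
divisible by `5`.** [folklore] -/
theorem coFive_int_false {M e N : ℤ} (hcop : ¬ (((5 : ℕ) : ℤ) ∣ M ∧ ((5 : ℕ) : ℤ) ∣ e))
    (h : N ^ 2 = 5 * M ^ 4 - 2940 * M ^ 2 * e ^ 2 + 439040 * e ^ 4) : False := by
  have hA := five_dvd_step (N := N) (A := M ^ 4 - 588 * M ^ 2 * e ^ 2 + 87808 * e ^ 4) (by linear_combination h)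
  push_cast at hA
  exact hcop (dvd_and_dvd_of_zmod_five (coFive_residue _ _ hA))

/-- **`W⁵′`, `d = 10`: `N² = 10M⁴ − 2940M²e² + 219520e⁴` has no integer point with `M`, `e` not
both divisible by `5`.** [folklore] -/
theorem coTen_int_false {M e N : ℤ} (hcop : ¬ (((5 : ℕ) : ℤ) ∣ M ∧ ((5 : ℕ) : ℤ) ∣ e))
    (h : N ^ 2 = 10 * M ^ 4 - 2940 * M ^ 2 * e ^ 2 + 219520 * e ^ 4) : False := by
  have hA := five_dvd_step (N := N) (A := 2 * M ^ 4 - 588 * M ^ 2 * e ^ 2 + 43904 * e ^ 4) (by linear_combination h)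
  push_cast at hA
  exact hcop (dvd_and_dvd_of_zmod_five (coTen_residue _ _ hA))

/-- **`z² = 5u⁴ + 1470u² − 1715` has no rational solution** (`W⁵`, class `[5]`). [folklore] -/
theorem five_rat_false (u z : ℚ) (h : z ^ 2 = 5 * u ^ 4 + 1470 * u ^ 2 - 1715) : False := by
  obtain ⟨M, e, N, hg, -, hN⟩ := exists_int_torsor (d := 5) (a := 1470) (c := -1715) (u := u)
    (z := z) (by push_cast; linear_combination h)
  exact five_int_false (N := N) (not_dvd_and_dvd_of_gcd_eq_one hg (p := 5) (by norm_num))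
    (by linear_combination hN)

/-- **`z² = −5u⁴ + 1470u² + 1715` has no rational solution** (`W⁵`, class `[−5]`). [folklore] -/
theorem negFive_rat_false (u z : ℚ) (h : z ^ 2 = -5 * u ^ 4 + 1470 * u ^ 2 + 1715) : False := by
  obtain ⟨M, e, N, hg, -, hN⟩ := exists_int_torsor (d := -5) (a := 1470) (c := 1715) (u := u)
    (z := z) (by push_cast; linear_combination h)
  exact negFive_int_false (N := N) (not_dvd_and_dvd_of_gcd_eq_one hg (p := 5) (by norm_num))
    (by linear_combination hN)

/-- **`z² = 5u⁴ − 2940u² + 439040` has no rational solution** (`W⁵′`, class `[5]`). [folklore] -/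
theorem coFive_rat_false (u z : ℚ) (h : z ^ 2 = 5 * u ^ 4 - 2940 * u ^ 2 + 439040) : False := by
  obtain ⟨M, e, N, hg, -, hN⟩ := exists_int_torsor (d := 5) (a := -2940) (c := 439040) (u := u)
    (z := z) (by push_cast; linear_combination h)
  exact coFive_int_false (N := N) (not_dvd_and_dvd_of_gcd_eq_one hg (p := 5) (by norm_num))
    (by linear_combination hN)

/-- **`z² = 10u⁴ − 2940u² + 219520` has no rational solution** (`W⁵′`, class `[10]`). [folklore] -/
theorem coTen_rat_false (u z : ℚ) (h : z ^ 2 = 10 * u ^ 4 - 2940 * u ^ 2 + 219520) : False := by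
  obtain ⟨M, e, N, hg, -, hN⟩ := exists_int_torsor (d := 10) (a := -2940) (c := 219520) (u := u)
    (z := z) (by push_cast; linear_combination h)
  exact coTen_int_false (N := N) (not_dvd_and_dvd_of_gcd_eq_one hg (p := 5) (by norm_num))
    (by linear_combination hN)

/-! ### `W⁵′`, class `[2]`: the torsor `N² = 2M⁴ − 2940M²e² + 1097600e⁴` dies `2`-adically -/

/-- Step 0: for `M = 2k + 1` odd, `2M⁴ − 2940M²e² + 1097600e⁴ ≡ 2 (mod 4)` is not a square.
[folklore] -/
theorem coTwo_step0 :
    ∀ k e n : ZMod 4, n ^ 2 ≠ 2 * (2 * k + 1) ^ 4 - 2940 * (2 * k + 1) ^ 2 * e ^ 2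
      + 1097600 * e ^ 4 := by
  decide

/-- Step 1: for `M₁ = 2k + 1`, `e = 2l + 1` odd, `2M₁⁴ − 735M₁²e² + 68600e⁴ ≡ 3 (mod 8)` is not a
square. [folklore] -/
theorem coTwo_step1 :
    ∀ k l n : ZMod 8, n ^ 2 ≠ 2 * (2 * k + 1) ^ 4 - 735 * (2 * k + 1) ^ 2 * (2 * l + 1) ^ 2
      + 68600 * (2 * l + 1) ^ 4 := by
  decide

/-- Step 2: for `e = 2l + 1` odd and any `m`, `8m⁴ − 735m²e² + 17150e⁴ ≡ 2, 6, 7 (mod 8)` is not a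
square. [folklore] -/
theorem coTwo_step2 :
    ∀ m l n : ZMod 8, n ^ 2 ≠ 8 * m ^ 4 - 735 * m ^ 2 * (2 * l + 1) ^ 2
      + 17150 * (2 * l + 1) ^ 4 := by
  decide

/-- `4 ∣ N` from `16 ∣ N²`, and `2 ∣ N` from `4 ∣ N²`. [folklore] -/
theorem dvd_of_sq_dvd_sq {c N : ℤ} (h : c ^ 2 ∣ N ^ 2) : c ∣ N :=
  (Int.pow_dvd_pow_iff two_ne_zero).mp h

/-- **The torsor `N² = 2M⁴ − 2940M²e² + 1097600e⁴` has no integer point with `M`, `e` not both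
even**: the three-step `2`-adic parity chain. [folklore] -/
theorem coTwo_int_false {M e N : ℤ} (hcop : ¬ (2 ∣ M ∧ 2 ∣ e))
    (h : N ^ 2 = 2 * M ^ 4 - 2940 * M ^ 2 * e ^ 2 + 1097600 * e ^ 4) : False := by
  rcases Int.even_or_odd M with ⟨M₁, hM⟩ | ⟨k, hk⟩
  · -- `M = 2M₁` even, so `e = 2l + 1` odd
    rcases Int.even_or_odd e with ⟨l, hl⟩ | ⟨l, hl⟩
    · exact hcop ⟨⟨M₁, by rw [hM]; ring⟩, ⟨l, by rw [hl]; ring⟩⟩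
    rw [← two_mul] at hM
    subst hM
    -- `N = 4 N₁`
    have h16 : (4 : ℤ) ^ 2 ∣ N ^ 2 :=
      ⟨2 * M₁ ^ 4 - 735 * M₁ ^ 2 * e ^ 2 + 68600 * e ^ 4, by rw [h]; ring⟩
    obtain ⟨N₁, rfl⟩ := dvd_of_sq_dvd_sq h16
    have h₁ : N₁ ^ 2 = 2 * M₁ ^ 4 - 735 * M₁ ^ 2 * e ^ 2 + 68600 * e ^ 4 := by
      have h' : (16 : ℤ) * N₁ ^ 2 = 16 * (2 * M₁ ^ 4 - 735 * M₁ ^ 2 * e ^ 2 + 68600 * e ^ 4) := by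
        linear_combination h
      exact mul_left_cancel₀ (by norm_num) h'
    rcases Int.even_or_odd M₁ with ⟨M₂, hM₁⟩ | ⟨k, hk⟩
    · rw [← two_mul] at hM₁
      subst hM₁
      -- `N₁ = 2 N₂`
      have h4 : (2 : ℤ) ^ 2 ∣ N₁ ^ 2 :=
        ⟨8 * M₂ ^ 4 - 735 * M₂ ^ 2 * e ^ 2 + 17150 * e ^ 4, by rw [h₁]; ring⟩
      obtain ⟨N₂, rfl⟩ := dvd_of_sq_dvd_sq h4
      have h₂ : N₂ ^ 2 = 8 * M₂ ^ 4 - 735 * M₂ ^ 2 * e ^ 2 + 17150 * e ^ 4 := by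
        have h' : (4 : ℤ) * N₂ ^ 2 = 4 * (8 * M₂ ^ 4 - 735 * M₂ ^ 2 * e ^ 2 + 17150 * e ^ 4) := by
          linear_combination h₁
        exact mul_left_cancel₀ (by norm_num) h'
      subst hl
      have h8 := congrArg (Int.cast : ℤ → ZMod 8) h₂
      push_cast at h8
      exact coTwo_step2 _ _ _ h8
    · subst hk hl
      have h8 := congrArg (Int.cast : ℤ → ZMod 8) h₁
      push_cast at h8
      exact coTwo_step1 _ _ _ h8
  · subst hk
    have h4 := congrArg (Int.cast : ℤ → ZMod 4) h
    push_cast at h4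
    exact coTwo_step0 _ _ _ h4

/-- **`z² = 2u⁴ − 2940u² + 1097600` has no rational solution** (`W⁵′`, class `[2]`). [folklore] -/
theorem coTwo_rat_false (u z : ℚ) (h : z ^ 2 = 2 * u ^ 4 - 2940 * u ^ 2 + 1097600) : False := by
  obtain ⟨M, e, N, hg, -, hN⟩ := exists_int_torsor (d := 2) (a := -2940) (c := 1097600) (u := u)
    (z := z) (by push_cast; linear_combination h)
  refine coTwo_int_false (M := M) (e := e) (N := N) ?_ (by linear_combination hN)
  exact_mod_cast not_dvd_and_dvd_of_gcd_eq_one hg (p := 2) one_lt_two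

end Summit.Langlands.Langlands.Theorems.SqrtFiveQuarticCovers.W5Descent
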